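import Summits.BirchSwinnertonDyer.BirchSwinnertonDyer.Theorems.AdditiveBranchIMCTwistFieldBaseChangePair
import Summits.BirchSwinnertonDyer.Rank1Residual.Additive.X3BranchGordEndStateIntrinsic
import Summits.BirchSwinnertonDyer.Rank1Residual.Additive.LocalTowerKernelAtPTwistedOrdinaryTwo
import Summits.BirchSwinnertonDyer.Rank1Residual.Additive.ChiBranchLowerTransportGord
import Summits.BirchSwinnertonDyer.Rank1Residual.Additive.ChiBranchLowerInputOdd
import Summits.BirchSwinnertonDyer.Rank1Residual.Additive.CycLeadingTermDvdIff
import HarnessLib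

/-!
# Crux `GordTwoRankZeroOffCaseOne` (route `AdditiveBranchIMC`, item 19357), lane k1-c2x gen 2: the
# twist-field road in DESCENDED shape — Part 3: the rank-0 DOORS on cell (G-ord, `e = 2`) at ANY image

Sequel of `…TwistFieldBaseChange` / `…TwistFieldBaseChangePair`. Cell `bsd-addord`, seat
`bsd-addord-k1-c2x`. ROUTE-CONE-FREE since gen 3 (2026-08-27, referee advisory N-g41-1): the two doors no
longer import k1-c2's p418190 `…GordTwoRankZeroTransport` (which imports the route file); its §1–§2
transport (Delbourgo 1998 Prop. 4 intrinsic + local tower kernel killed + the branch constant term) is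
re-derived below from the SAME cone-free `Rank1Residual.Additive` theorems, statements of §5 unchanged.
HONEST FRAMING: theorems only; every published input
is a DISPLAYED named-fact binder (Kato 2004 Thm. 17.4 `kato_divisibility`, clauses (1)(2) only — NO image
hypothesis; Rohrlich 1984 `padicLFunction_ne_zero`; Delbourgo 1998 Prop. 4 intrinsic; Pal 2012 Thm. 3.2;
GZK; modularity); torsion of `X(W/ℚ_∞)` is displayed (`hT`, the reading [C]); `GordTwistBaseChangeLower{Even,Odd}At W p`
is this lane's typed CONJECTURE (OPEN, nothing asserted); the unit coefficient is a displayed per-pair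
CERTIFICATE; nothing is booked; BSD is not proved by any of this.

* §5 **`missingLowerBoundAt_cellGordTwo_rankZero_of_baseChange_of_hasUnitContent`** /
  **`…_of_baseChangeOdd_of_hasUnitContent`** — `ord_p #Ш(E)_an ≤ ord_p #Ш(E)` (`MissingLowerBoundAt W p`)
  on a pair of cell (G-ord, `e = 2`) in analytic rank `0`, both parities, for ANY image of `ρ̄_{W,p}`, from
  (BC-Gord), ONE unit coefficient of the Néron-normalised branch `p`-adic `L`-function of the twist model,
  and the named facts. Lane A's doors (`…Desc3Door`, `…DescPDoorFiveLe`) need `Surj W p` and a Selmer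
  witness; these need (BC-Gord) (OPEN) and a `μ`-certificate — complementary clientele (the cell's
  non-surjective rank-`0` rows).

References: D. Delbourgo, Compositio 113 (1998) Prop. 4 [Delbourgo1998]; V. Pal, Proc. AMS 140 (2012)
Thm. 3.2 [Pal2012]; K. Kato, Astérisque 295 (2004) Thm. 17.4 [Kato2004Asterisque]; D. Rohrlich, Invent.
Math. 75 (1984) [RohrlichInventiones1984]; Mazur–Tate–Teitelbaum, Invent. Math. 84 (1986) §I.14
[MazurTateTeitelbaum1986Invent].
-/

set_option autoImplicit false
set_option linter.dupNamespace false

noncomputable section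

open scoped Classical MatrixGroups ModularForm

open CongruenceSubgroup WeierstrassCurve Literature.NumberTheory.EllipticCurves
  Literature.NumberTheory.EllipticCurves.ModularForms
  Literature.NumberTheory.EllipticCurves.Rank1Residual
  Literature.NumberTheory.EllipticCurves.Rank1Residual.Typed
  Literature.NumberTheory.GaloisRepresentations
  Literature.NumberTheory.EllipticCurves.GreenbergVatsal2000

namespace Summit.BirchSwinnertonDyer.BirchSwinnertonDyer.Theorems.AdditiveBranchIMCTwistField

open Summit.BirchSwinnertonDyer.Rank1Residual.Additive
open Summit.BirchSwinnertonDyer.Rank1Residual.Additive (TowerSelmerDualData towerSelmerDualData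
  isCyclotomicVariable_mul_of_mem_kerSubgroup)
open Summit.BirchSwinnertonDyer.Rank1Residual.AdditivePotMult (exists_mul_mem_galRange
  isTopGenerator_mul_of_mem_kerSubgroup conjH1_mul_of_mem_kerSubgroup)

/-! ## §5 Doors: the rank-0 lower half on cell (G-ord, `e = 2`) at ANY image, modulo (BC-Gord) and the
certificate (k1-c2's p418190 §2 consumers) -/

section Doors

variable {W : WeierstrassCurve ℚ} [W.IsElliptic] [W.IsGloballyMinimal] {p : ℕ} [hp : Fact p.Prime]

/-- (gen 3, cone-free re-derivation of k1-c2's p418190 §1 on the cell.) **`ExactLeadingTermAt W p` on a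
pair of cell (G-ord, `e = 2`) in analytic rank `0`**: Delbourgo 1998 Thm. 3 + Prop. 4 in intrinsic form
(`hDelG`: `g(0)·#E(ℚ)² = u·#Ш(E)(p)·#𝒦₀·∏_{ν≠p} c_ν`, `𝒦₀` the local tower kernel at `p`) with `𝒦₀ = ⊥`
on the good ordinary twist model (`GoodModelLine.ClassX4Gord/ClassX3Gord.localTowerKerPrimary_zero_eq_bot`,
Greenberg LNM 1716 Lemma 3.4 / Prop. 3.8); `E(ℚ)`, `Ш(E)` finite by Gross–Zagier–Kolyvagin (`hGZK`).
Image-free (X3 and X4 rows alike). [cite: Delbourgo1998, Thm. 3 (p. 143) and Prop. 4 (p. 144)]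
[cite: GreenbergLNM1716, §3 Lemma 3.4 (p. 89) and Prop. 3.8 (p. 95)] -/
theorem exactLeadingTermAt_cellGordTwo_rankZero
    (hDelG : Delbourgo1998.prop4_rankZero_constantCoeff_eq_unit_mul_of_potGoodOrd)
    (hGZK : rank_eq_analyticRank_of_analyticRank_le_one)
    (hc : N10.CellGordTwo W p) (hr : W.analyticRank = 0) : ExactLeadingTermAt W p := by
  intro κ γ hκ hγ D
  obtain ⟨hmw, hfin⟩ := hGZK W (by rw [hr]; exact zero_le_one)
  have hmw0 : W.mordellWeilRank = 0 := by rw [hmw, hr]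
  haveI : Finite W.sha := hfin
  haveI hE : Finite W.toAffine.Point := W.finite_point_of_rank_zero hmw0
  obtain ⟨v, hv⟩ := exists_heightOneSpectrum_natCast_mem ℚ p
  obtain ⟨-, -, g, hgmem, -, u, hgeq⟩ :=
    hDelG W p hc.1 hc.2.1 hc.2.2.1 hr hfin hE κ γ hκ hγ v hv D
  have hbot : W.localTowerKerPrimary κ (v.adicCompletion ℚ) 0 = ⊥ := by
    by_cases hirr : Irr W p
    · exact GoodModelLine.ClassX4Gord.localTowerKerPrimary_zero_eq_bot (W := W) (p := p)
        ⟨⟨hc.1, hc.2.1, hirr⟩, hc.2.2.1⟩ hv κ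
    · exact GoodModelLine.ClassX3Gord.localTowerKerPrimary_zero_eq_bot (W := W) (p := p) hc.1
        ⟨⟨hirr, hc.2.1⟩, hc.2.2.1⟩ hv κ
  have hcard : Nat.card (W.localTowerKerPrimary κ (v.adicCompletion ℚ) 0) = 1 := by
    rw [hbot]; exact AddSubgroup.card_bot
  rw [hcard, Nat.cast_one, mul_one] at hgeq
  exact ⟨g, hgmem, u, hgeq⟩

/-- **Door, `p ≡ 1 (mod 4)`**: on a pair of cell (G-ord, `e = 2`) in analytic rank `0`,
`ord_p #Ш(E)_an ≤ ord_p #Ш(E)` (`MissingLowerBoundAt W p`) from the descended product bound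
`GordTwistBaseChangeLowerEvenAt W p` (OPEN, typed), ONE unit coefficient of the Néron-normalised branch
`p`-adic `L`-function (finite certificate `hU`), and the named facts: Kato 17.4 (1)(2) (rational, no image
hypothesis), Rohrlich, torsion of `X(W/ℚ_∞)` (`hT`), Delbourgo 1998 Prop. 4 intrinsic (`hDelG`), Pal 2012
Thm. 3.2 (`hPal`), GZK, modularity (`hmod`, `hmodD`) — the cone-free re-derivation of k1-c2's
`missingLowerBoundAt_cellGordTwo_rankZero_of_chiBranchLowerDivisibility` (branch constant term by
Mazur–Tate–Teitelbaum §I.14, Birch + Pal on the even branch, the exact leading term above). NO image hypothesis on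
`ρ̄_{W,p}`: the door is open on the non-surjective rows of the cell as well. Nothing is booked.
[cite: Delbourgo1998, Prop. 4 (p. 144)] [cite: Pal2012, Thm. 3.2] [cite: Kato2004Asterisque, Thm. 17.4 (1)(2) (p. 273)]
[cite: RohrlichInventiones1984, Theorem (p. 409)] -/
theorem missingLowerBoundAt_cellGordTwo_rankZero_of_baseChange_of_hasUnitContent
    (hDelG : Delbourgo1998.prop4_rankZero_constantCoeff_eq_unit_mul_of_potGoodOrd)
    (hPal : Pal2012.thm32_sqrt_mul_realPeriodRat_twist_eq_of_prime_one_mod_four)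
    (hGZK : rank_eq_analyticRank_of_analyticRank_le_one) (hmod : hasEntireLFunction_rat)
    (hmodD : nonempty_modularParametrizationData)
    (hkato : ∀ (V : WeierstrassCurve ℚ) [V.IsElliptic] [V.IsGloballyMinimal] (κ : ZpExtension ℚ p)
      (γ : Field.absoluteGaloisGroup ℚ) (N : ℕ) [NeZero N] (f : CuspForm (Gamma0 N) 2),
      kato_divisibility V p (κ := κ) (γ := γ) (f := f))
    (hR : ∀ (V : WeierstrassCurve ℚ) [V.IsElliptic] [V.IsGloballyMinimal] (N : ℕ) [NeZero N]
      (f : CuspForm (Gamma0 N) 2), padicLFunction_ne_zero (W := V) (p := p) (f := f))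
    (hT : ∀ (κ : ZpExtension ℚ p) (γ : Field.absoluteGaloisGroup ℚ) (D : W.SelmerDualData κ γ),
      κ.IsCyclotomic → κ.IsTopGenerator γ → D.IsTorsion)
    (hc : N10.CellGordTwo W p) (hp4 : p % 4 = 1) (hr : W.analyticRank = 0)
    (hBC : GordTwistBaseChangeLowerEvenAt W p)
    (hU : ∀ (V : WeierstrassCurve ℚ) [V.IsElliptic] [V.IsGloballyMinimal] {N : ℕ} [NeZero N]
      (f : CuspForm (Gamma0 N) 2) (ϖ : ℚ), (∃ C : VariableChange ℚ, C • V.quadraticTwist (p : ℚ) = W) →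
      GoodOrd V p → IsNewformOf V f → (ϖ : ℝ) * V.realPeriodRat = plusPeriod f →
      ∃ b : IwasawaAlgebra p, iwasawaToPowerSeries p b =
        PowerSeries.C ((ϖ : ℚ) : ℚ_[p]) * padicLFunctionBranch f (unitRoot V p : ℚ_[p]) (p / 2) ∧
        HasUnitContent b) :
    MissingLowerBoundAt W p :=
  missingLowerBoundAt_of_cycLowerLeadingTerm_of_exact W p hGZK hmod hr
    ((cycLowerLeadingTermAt_iff_chiBranchLower_of_typeGOrd_of_semistabilityIndex_eq_two W p hPal hmod
        hmodD hp4 hc.2.1 hc.2.2.1 hc.2.2.2).mpr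
      (chiBranchLowerLeadingTermAt_of_divisibility_of_padicValRat_j_nonneg p W
        (padicValRat_j_nonneg_of_typeGOrd W p hc.2.2.1)
        (chiBranchLowerDivisibilityAt_of_baseChange_of_hasUnitContent hkato hR hT hBC hU)))
    (exactLeadingTermAt_cellGordTwo_rankZero hDelG hGZK hc hr)

/-- **Door, `p ≡ 3 (mod 4)`** (`p = 3` included): the odd twin, the cone-free re-derivation of k1-c2's
`missingLowerBoundAt_cellGordTwo_rankZero_of_chiBranchLowerDivisibilityOdd` (no Pal input on the odd
branch). NO image hypothesis. Nothing is booked. [cite: Delbourgo1998, Prop. 4 (p. 144)]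
[cite: Kato2004Asterisque, Thm. 17.4 (1)(2) (p. 273)] [cite: RohrlichInventiones1984, Theorem (p. 409)] -/
theorem missingLowerBoundAt_cellGordTwo_rankZero_of_baseChangeOdd_of_hasUnitContent
    (hDelG : Delbourgo1998.prop4_rankZero_constantCoeff_eq_unit_mul_of_potGoodOrd)
    (hGZK : rank_eq_analyticRank_of_analyticRank_le_one) (hmod : hasEntireLFunction_rat)
    (hmodD : nonempty_modularParametrizationData)
    (hkato : ∀ (V : WeierstrassCurve ℚ) [V.IsElliptic] [V.IsGloballyMinimal] (κ : ZpExtension ℚ p)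
      (γ : Field.absoluteGaloisGroup ℚ) (N : ℕ) [NeZero N] (f : CuspForm (Gamma0 N) 2),
      kato_divisibility V p (κ := κ) (γ := γ) (f := f))
    (hR : ∀ (V : WeierstrassCurve ℚ) [V.IsElliptic] [V.IsGloballyMinimal] (N : ℕ) [NeZero N]
      (f : CuspForm (Gamma0 N) 2), padicLFunction_ne_zero (W := V) (p := p) (f := f))
    (hT : ∀ (κ : ZpExtension ℚ p) (γ : Field.absoluteGaloisGroup ℚ) (D : W.SelmerDualData κ γ),
      κ.IsCyclotomic → κ.IsTopGenerator γ → D.IsTorsion)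
    (hc : N10.CellGordTwo W p) (hp4 : p % 4 = 3) (hr : W.analyticRank = 0)
    (hBC : GordTwistBaseChangeLowerOddAt W p)
    (hU : ∀ (V : WeierstrassCurve ℚ) [V.IsElliptic] [V.IsGloballyMinimal] {N : ℕ} [NeZero N]
      (f : CuspForm (Gamma0 N) 2) (ϖ : ℚ),
      (∃ C : VariableChange ℚ, C • V.quadraticTwist (-(p : ℚ)) = W) →
      GoodOrd V p → IsNewformOf V f → (ϖ : ℝ) * V.imaginaryPeriodRat = minusPeriod f →
      ∃ b : IwasawaAlgebra p, iwasawaToPowerSeries p b =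
        PowerSeries.C ((ϖ : ℚ) : ℚ_[p]) * padicLFunctionMinusBranch f (unitRoot V p : ℚ_[p]) (p / 2) ∧
        HasUnitContent b) :
    MissingLowerBoundAt W p :=
  missingLowerBoundAt_of_cycLowerLeadingTerm_of_exact W p hGZK hmod hr
    ((cycLowerLeadingTermAt_iff_chiBranchLowerOdd_of_typeGOrd_of_semistabilityIndex_eq_two W p hmod
        hmodD hp4 hc.2.1 hc.2.2.1 hc.2.2.2).mpr
      (chiBranchLowerLeadingTermOddAt_of_divisibilityOdd_of_padicValRat_j_nonneg p W
        (padicValRat_j_nonneg_of_typeGOrd W p hc.2.2.1)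
        (chiBranchLowerDivisibilityOddAt_of_baseChangeOdd_of_hasUnitContent hkato hR hT hBC hU)))
    (exactLeadingTermAt_cellGordTwo_rankZero hDelG hGZK hc hr)

end Doors

end Summit.BirchSwinnertonDyer.BirchSwinnertonDyer.Theorems.AdditiveBranchIMCTwistField

end
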